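import Summits.CriticalPhenomena.CardyFormulaZ2.Theorems.CardyBoundaryCoulombGasRectilinearCardyClosureDefs
import Summits.CriticalPhenomena.CardyFormulaZ2.Theorems.RectilinearCardy.Negative.RectilinearCardyReductions
import HarnessLib

/-!
# Stub `stub_chartAlgebra` of line `excursion-kernel-covariance`
# (crux `RectilinearCardy`, stmt-CriticalPhenomena-5660, route `CardyBoundaryCoulombGas`): the
# conjugate chart and the engine's exponents at `(1,3,1,1; j = 1)`

Three independent elementary facts used by the lead's composition `stub_pointwiseFromEngineG` when the
route engine `BoundaryDefectGaussianR` is applied at `k = 4`, `L = ![1,3,1,1]`, `j = 1` (charges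
`e = (1, 1 - 3, 1, 1) = (1, -2, 1, 1)`, Kac weights `h(e) = e (e - 1) / 6 = (0, 1, 0, 0)`), and, for
counter-clockwise domains, to the complex-conjugate configuration with the conjugate chart
`w_σ z = -conj (w (conj z))`:

* (a) for `w` holomorphic on an open `U`: `{z | conj z ∈ U}` is open (preimage under the continuous
  involution `conj`), `w_σ` is `ℂ`-differentiable there with `deriv w_σ z = -conj (deriv w (conj z))`
  (Mathlib's `differentiableAt_conj_conj_iff` and the unconditional `deriv_conj_conj`), and `w_σ` maps
  `{z | conj z ∈ Ω}` bijectively onto the upper half plane when `w` maps `Ω` bijectively onto it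
  (`Im (-conj h) = Im h`, `conj ∘ conj = id`);
* (b) the closed form of the engine's limit product: the pair exponents `e_i e_{i'} / 3` are `-2/3` on the
  three pairs through the index `1` and `1/3` on the other three, the derivative exponents
  `e_i (e_i - 1) / 6` are `(0, 1, 0, 0)`; the finite products are expanded (`Fin.prod_univ_four`, the
  filters `{i' | i < i'}` computed by `decide`) and regrouped with `Real.mul_rpow`,
  `Real.rpow_natCast_mul` (`(x ^ 2) ^ (-1/3) = x ^ (-2/3)` for `x ≥ 0`) and `norm_sub_rev`;
* (c) `δ ^ (-(Σ_i h_i)) = δ ^ (-1) = δ⁻¹` (`Fin.sum_univ_four`, `Real.rpow_neg_one`).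

All three are folklore bookkeeping; no percolation input.
-/

noncomputable section

open Set Filter Topology MeasureTheory Metric
open Literature.Probability.RandomPlanarGeometry
open Literature.Probability.LatticeModels (Site meshPoint zdGraph)
open Summit.CriticalPhenomena.CardyFormulaZ2.Theorems.RectilinearCardy.Negative (IsRectilinear)

namespace Summit.CriticalPhenomena.CardyFormulaZ2.Cruxes.RectilinearCardy.ExcursionKernelCovariance

/-- **The conjugate chart.** For `w` holomorphic on an open `U`, the reflected set `{z | conj z ∈ U}` is
open, `z ↦ -conj (w (conj z))` is holomorphic on it with derivative `-conj (w' (conj z))`, and it maps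
`{z | conj z ∈ Ω}` bijectively onto the upper half plane whenever `w` maps `Ω` bijectively onto the upper
half plane. [folklore] -/
theorem conjChart_holomorphic (U : Set ℂ) (w : ℂ → ℂ) (hU : IsOpen U) (hw : DifferentiableOn ℂ w U) :
    IsOpen {z : ℂ | (starRingEnd ℂ) z ∈ U} ∧
    DifferentiableOn ℂ (fun z => -(starRingEnd ℂ) (w ((starRingEnd ℂ) z)))
      {z : ℂ | (starRingEnd ℂ) z ∈ U} ∧
    (∀ z : ℂ, (starRingEnd ℂ) z ∈ U →
      deriv (fun z => -(starRingEnd ℂ) (w ((starRingEnd ℂ) z))) z =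
        -(starRingEnd ℂ) (deriv w ((starRingEnd ℂ) z))) ∧
    (∀ Ω : Set ℂ, BijOn w Ω {z : ℂ | 0 < z.im} →
      BijOn (fun z => -(starRingEnd ℂ) (w ((starRingEnd ℂ) z))) {z : ℂ | (starRingEnd ℂ) z ∈ Ω}
        {z : ℂ | 0 < z.im}) := by
  have hcomp : (fun z => (starRingEnd ℂ) (w ((starRingEnd ℂ) z))) =
      (starRingEnd ℂ) ∘ w ∘ (starRingEnd ℂ) := rfl
  refine ⟨hU.preimage Complex.continuous_conj, ?_, ?_, ?_⟩
  · -- holomorphy: Mathlib's `conj ∘ w ∘ conj` criterion, pointwise on the open reflected set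
    intro z hz
    have hd : DifferentiableAt ℂ w ((starRingEnd ℂ) z) := hw.differentiableAt (hU.mem_nhds hz)
    have h1 : DifferentiableAt ℂ (fun z => (starRingEnd ℂ) (w ((starRingEnd ℂ) z))) z := by
      rw [hcomp]
      exact differentiableAt_conj_conj_iff.2 hd
    exact h1.neg.differentiableWithinAt
  · -- the derivative: `deriv (conj ∘ w ∘ conj) = conj ∘ deriv w ∘ conj` unconditionally
    intro z _
    rw [deriv.fun_neg, hcomp, deriv_conj_conj]
    rfl
  · -- bijectivity onto the upper half plane
    intro Ω hΩ
    refine ⟨?_, ?_, ?_⟩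
    · intro z hz
      have h1 := hΩ.mapsTo hz
      simp only [mem_setOf_eq] at h1 ⊢
      rw [Complex.neg_im, Complex.conj_im, neg_neg]
      exact h1
    · intro z₁ hz₁ z₂ hz₂ h
      have h' : w ((starRingEnd ℂ) z₁) = w ((starRingEnd ℂ) z₂) := by
        have := congrArg (fun u => (starRingEnd ℂ) (-u)) h
        simpa using this
      have h2 := hΩ.injOn hz₁ hz₂ h'
      rw [← Complex.conj_conj z₁, ← Complex.conj_conj z₂, h2]
    · intro h hh
      have hh' : -(starRingEnd ℂ) h ∈ {z : ℂ | 0 < z.im} := by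
        simp only [mem_setOf_eq] at hh ⊢
        rw [Complex.neg_im, Complex.conj_im, neg_neg]
        exact hh
      obtain ⟨u, hu, hwu⟩ := hΩ.surjOn hh'
      refine ⟨(starRingEnd ℂ) u, ?_, ?_⟩
      · show (starRingEnd ℂ) ((starRingEnd ℂ) u) ∈ Ω
        rw [Complex.conj_conj]
        exact hu
      · show -(starRingEnd ℂ) (w ((starRingEnd ℂ) ((starRingEnd ℂ) u))) = h
        rw [Complex.conj_conj, hwu, map_neg, Complex.conj_conj, neg_neg]

/-- **The engine's limit product at `(1,3,1,1; j = 1)` in closed form.** With charges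
`e = (1, -2, 1, 1)`: `C ∏_{i<i'} |w_i - w_{i'}|^{e_i e_{i'}/3} ∏_i |w'_i|^{e_i (e_i-1)/6}
= C (|w_0-w_2| |w_0-w_3| |w_2-w_3|)^{1/3} · |w'_1| (∏_{p ≠ 1} |w_1 - w_p|²)^{-1/3}`.
The three separation hypotheses are not needed (Mathlib's `0 ^ x = 0` conventions make both sides agree
in the degenerate cases) and are taken anonymously. [folklore] -/
theorem engineProduct_closedForm (w : ℂ → ℂ) (P : Fin 4 → ℂ) (C : ℝ) (_ : w (P 1) ≠ w (P 0))
    (_ : w (P 1) ≠ w (P 2)) (_ : w (P 1) ≠ w (P 3)) :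
    C * (∏ i : Fin 4, ∏ i' ∈ Finset.univ.filter (fun i' : Fin 4 ↦ i < i'),
        ‖w (P i) - w (P i')‖ ^
          ((if i = (1 : Fin 4) then (1 - ((![1, 3, 1, 1] : Fin 4 → ℕ) 1 : ℝ))
              else ((![1, 3, 1, 1] : Fin 4 → ℕ) i : ℝ)) *
            (if i' = (1 : Fin 4) then (1 - ((![1, 3, 1, 1] : Fin 4 → ℕ) 1 : ℝ))
              else ((![1, 3, 1, 1] : Fin 4 → ℕ) i' : ℝ)) / 3)) *
      ∏ i : Fin 4, ‖deriv w (P i)‖ ^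
        ((if i = (1 : Fin 4) then (1 - ((![1, 3, 1, 1] : Fin 4 → ℕ) 1 : ℝ))
            else ((![1, 3, 1, 1] : Fin 4 → ℕ) i : ℝ)) *
          ((if i = (1 : Fin 4) then (1 - ((![1, 3, 1, 1] : Fin 4 → ℕ) 1 : ℝ))
            else ((![1, 3, 1, 1] : Fin 4 → ℕ) i : ℝ)) - 1) / 6) =
    C * (‖w (P 0) - w (P 2)‖ * ‖w (P 0) - w (P 3)‖ * ‖w (P 2) - w (P 3)‖) ^ (1 / 3 : ℝ) *
      (‖deriv w (P 1)‖ *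
        (‖w (P 1) - w (P 3)‖ ^ 2 * ‖w (P 1) - w (P 2)‖ ^ 2 * ‖w (P 1) - w (P 0)‖ ^ 2) ^
          (-(1 / 3 : ℝ))) := by
  -- the index filters `{i' | i < i'}` of `Fin 4`
  have hf0 : Finset.univ.filter (fun i' : Fin 4 ↦ (0 : Fin 4) < i') = {1, 2, 3} := by decide
  have hf1 : Finset.univ.filter (fun i' : Fin 4 ↦ (1 : Fin 4) < i') = {2, 3} := by decide
  have hf2 : Finset.univ.filter (fun i' : Fin 4 ↦ (2 : Fin 4) < i') = {3} := by decide
  have hf3 : Finset.univ.filter (fun i' : Fin 4 ↦ (3 : Fin 4) < i') = ∅ := by decide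
  rw [Fin.prod_univ_four, Fin.prod_univ_four, hf0, hf1, hf2, hf3]
  rw [Finset.prod_insert (by decide), Finset.prod_insert (by decide), Finset.prod_singleton,
    Finset.prod_insert (by decide), Finset.prod_singleton, Finset.prod_singleton, Finset.prod_empty]
  -- the charges `e = (1, -2, 1, 1)` and the exponents `-2/3, 1/3; 0, 1, 0, 0`
  simp only [Matrix.cons_val_zero, Matrix.cons_val_one, Matrix.cons_val,
    show (2 : Fin 4) ≠ 1 from by decide, show (3 : Fin 4) ≠ 1 from by decide,
    show (0 : Fin 4) ≠ 1 from by decide, if_false, if_true]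
  norm_num
  -- regroup the right-hand side
  have hn : ∀ i j : Fin 4, 0 ≤ ‖w (P i) - w (P j)‖ := fun i j => norm_nonneg _
  rw [Real.mul_rpow (mul_nonneg (hn 0 2) (hn 0 3)) (hn 2 3), Real.mul_rpow (hn 0 2) (hn 0 3),
    Real.mul_rpow (mul_nonneg (pow_nonneg (hn 1 3) 2) (pow_nonneg (hn 1 2) 2))
      (pow_nonneg (hn 1 0) 2),
    Real.mul_rpow (pow_nonneg (hn 1 3) 2) (pow_nonneg (hn 1 2) 2),
    ← Real.rpow_natCast_mul (hn 1 3), ← Real.rpow_natCast_mul (hn 1 2),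
    ← Real.rpow_natCast_mul (hn 1 0), norm_sub_rev (w (P 1)) (w (P 0))]
  norm_num
  ring

/-- **The mesh prefactor.** The Kac weights of `e = (1, -2, 1, 1)` sum to `1`, so the engine's
`δ ^ (-(Σ h))` is `δ⁻¹` (positivity of `δ` is not needed and is taken anonymously). [folklore] -/
theorem meshPrefactor_eq_inv (δ : ℝ) (_ : 0 < δ) :
    δ ^ (-(∑ i : Fin 4, (if i = (1 : Fin 4) then (1 - ((![1, 3, 1, 1] : Fin 4 → ℕ) 1 : ℝ))
        else ((![1, 3, 1, 1] : Fin 4 → ℕ) i : ℝ)) *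
      ((if i = (1 : Fin 4) then (1 - ((![1, 3, 1, 1] : Fin 4 → ℕ) 1 : ℝ))
        else ((![1, 3, 1, 1] : Fin 4 → ℕ) i : ℝ)) - 1) / 6)) = δ⁻¹ := by
  rw [Fin.sum_univ_four]
  simp only [Matrix.cons_val_zero, Matrix.cons_val_one, Matrix.cons_val,
    show (2 : Fin 4) ≠ 1 from by decide, show (3 : Fin 4) ≠ 1 from by decide,
    show (0 : Fin 4) ≠ 1 from by decide, if_false, if_true]
  norm_num
  exact Real.rpow_neg_one δ

/-- **Stub `stub_chartAlgebra` (M; registered signature, verbatim).** The conjunction of: (a) the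
conjugate chart `z ↦ -conj (w (conj z))` of a chart holomorphic on an open `U` is holomorphic on
`{z | conj z ∈ U}` with derivative `-conj (w' (conj z))` and maps `{z | conj z ∈ Ω}` bijectively onto
the upper half plane when `w` maps `Ω` onto it; (b) the closed form of the route engine's limit product
at `k = 4`, `L = ![1,3,1,1]`, `j = 1`; (c) `δ ^ (-(Σ weights)) = δ⁻¹`. [folklore] -/
theorem stub_chartAlgebra :
    (∀ (U : Set ℂ) (w : ℂ → ℂ), IsOpen U → DifferentiableOn ℂ w U →
        IsOpen {z : ℂ | (starRingEnd ℂ) z ∈ U} ∧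
        DifferentiableOn ℂ (fun z => -(starRingEnd ℂ) (w ((starRingEnd ℂ) z)))
          {z : ℂ | (starRingEnd ℂ) z ∈ U} ∧
        (∀ z : ℂ, (starRingEnd ℂ) z ∈ U →
          deriv (fun z => -(starRingEnd ℂ) (w ((starRingEnd ℂ) z))) z =
            -(starRingEnd ℂ) (deriv w ((starRingEnd ℂ) z))) ∧
        (∀ Ω : Set ℂ, BijOn w Ω {z : ℂ | 0 < z.im} →
          BijOn (fun z => -(starRingEnd ℂ) (w ((starRingEnd ℂ) z))) {z : ℂ | (starRingEnd ℂ) z ∈ Ω}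
            {z : ℂ | 0 < z.im})) ∧
    (∀ (w : ℂ → ℂ) (P : Fin 4 → ℂ) (C : ℝ), w (P 1) ≠ w (P 0) → w (P 1) ≠ w (P 2) → w (P 1) ≠ w (P 3) →
        C * (∏ i : Fin 4, ∏ i' ∈ Finset.univ.filter (fun i' : Fin 4 ↦ i < i'),
            ‖w (P i) - w (P i')‖ ^
              ((if i = (1 : Fin 4) then (1 - ((![1, 3, 1, 1] : Fin 4 → ℕ) 1 : ℝ))
                  else ((![1, 3, 1, 1] : Fin 4 → ℕ) i : ℝ)) *
                (if i' = (1 : Fin 4) then (1 - ((![1, 3, 1, 1] : Fin 4 → ℕ) 1 : ℝ))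
                  else ((![1, 3, 1, 1] : Fin 4 → ℕ) i' : ℝ)) / 3)) *
          ∏ i : Fin 4, ‖deriv w (P i)‖ ^
            ((if i = (1 : Fin 4) then (1 - ((![1, 3, 1, 1] : Fin 4 → ℕ) 1 : ℝ))
                else ((![1, 3, 1, 1] : Fin 4 → ℕ) i : ℝ)) *
              ((if i = (1 : Fin 4) then (1 - ((![1, 3, 1, 1] : Fin 4 → ℕ) 1 : ℝ))
                else ((![1, 3, 1, 1] : Fin 4 → ℕ) i : ℝ)) - 1) / 6) =
        C * (‖w (P 0) - w (P 2)‖ * ‖w (P 0) - w (P 3)‖ * ‖w (P 2) - w (P 3)‖) ^ (1 / 3 : ℝ) *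
          (‖deriv w (P 1)‖ *
            (‖w (P 1) - w (P 3)‖ ^ 2 * ‖w (P 1) - w (P 2)‖ ^ 2 * ‖w (P 1) - w (P 0)‖ ^ 2) ^
              (-(1 / 3 : ℝ)))) ∧
    (∀ δ : ℝ, 0 < δ →
        δ ^ (-(∑ i : Fin 4, (if i = (1 : Fin 4) then (1 - ((![1, 3, 1, 1] : Fin 4 → ℕ) 1 : ℝ))
            else ((![1, 3, 1, 1] : Fin 4 → ℕ) i : ℝ)) *
          ((if i = (1 : Fin 4) then (1 - ((![1, 3, 1, 1] : Fin 4 → ℕ) 1 : ℝ))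
            else ((![1, 3, 1, 1] : Fin 4 → ℕ) i : ℝ)) - 1) / 6)) = δ⁻¹) :=
  ⟨conjChart_holomorphic, engineProduct_closedForm, meshPrefactor_eq_inv⟩

end Summit.CriticalPhenomena.CardyFormulaZ2.Cruxes.RectilinearCardy.ExcursionKernelCovariance

end
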